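import Summits.NavierStokesRegularity.NavierStokesRegularity.Theorems.ThreadingFluxHorizonTowerProfileFormulas
import Summits.NavierStokesRegularity.NavierStokesRegularity.Theorems.ThreadingFluxHorizonTowerFirstLemmas
import HarnessLib

/-!
# The horizon profile: conjunct (6) `𝔏₁[U] ≡ 0`, and `HorizonProfileStructure` BY NAME
# (crux `PoloidalLiouville`, stmt-NavierStokesRegularity-1222, W1; ns-idea-15's «horizon-threading-tower»)

Support file (ARM A `pub/ns-exp-scalarLiouville` g3, DIRECTOR-NS #262 (2) option (B)).  For `U = horizonProfile l H 0 =
curl curl(‖z‖^{1−l}H z · z)` with `H` smooth, `l`-homogeneous (`l ≥ 1`) and harmonic, and `x ≠ 0`: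
`horizonL1 U 0 x = ‖x‖⟪x, curl(U × curl U)(x)⟫ = 0`.
Proof: the order-one flux identity at a point (`HorizonTower.inner_curl_cross_of_tangent`, p661847, with the tangency
`⟪curl U, z⟫ ≡ 0` of conjunct (3)) gives `⟪x, curl(U × curl U)⟫ = ⟪DU(x)[curl U(x)], x⟫ + ⟪U(x), curl U(x)⟫`; in the normal
form `U = 2∇φ − ψ y` (`ψ = div ∇φ`) one has `curl U(x) = −∇ψ(x) × x`, `D(∇φ)(x)[x] = 0` (Euler, `∇φ` of degree `0`),
`D²φ` symmetric, and `∇φ(x), ∇ψ(x) ∈ span{∇H(x), x}` (the explicit gradients of `H·(‖z‖²)^a`), so every term is a scalar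
triple product with a repeated vector.  Pure calculus; nothing about NS regularity.
-/

-- the summit and its single problem share the name (D-0017 nested layout)
set_option linter.dupNamespace false

noncomputable section

open Set Function Filter Topology InnerProductSpace
open scoped Topology RealInnerProductSpace

namespace Summit.NavierStokesRegularity.NavierStokesRegularity.Theorems.PoloidalLiouville.HorizonTower

open Literature.Analysis.FluidPDE PoloidalField

/-! ### Cross-product algebra -/

/-- `⟪a, a × x⟫ = 0`. -/
private theorem inner_cross_self_left (a x : EuclideanSpace ℝ (Fin 3)) : ⟪a, cross a x⟫ = 0 := by
  simp only [cross, PiLp.inner_apply, RCLike.inner_apply, conj_trivial, Fin.sum_univ_three, cross_apply,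
    Matrix.cons_val_zero, Matrix.cons_val_one, Matrix.cons_val_two, Matrix.head_cons, Matrix.tail_cons]
  ring

/-- `⟪x, a × x⟫ = 0`. -/
private theorem inner_self_cross (a x : EuclideanSpace ℝ (Fin 3)) : ⟪x, cross a x⟫ = 0 := by
  simp only [cross, PiLp.inner_apply, RCLike.inner_apply, conj_trivial, Fin.sum_univ_three, cross_apply,
    Matrix.cons_val_zero, Matrix.cons_val_one, Matrix.cons_val_two, Matrix.head_cons, Matrix.tail_cons]
  ring

/-- `⟪a × x, x⟫ = 0`. -/
private theorem inner_cross_self_right'' (a x : EuclideanSpace ℝ (Fin 3)) : ⟪cross a x, x⟫ = 0 := by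
  rw [real_inner_comm]; exact inner_self_cross a x

/-- If `b, c ∈ span{a, x}` then `⟪b, c × x⟫ = 0`. -/
private theorem inner_cross_eq_zero_of_span (a x : EuclideanSpace ℝ (Fin 3)) (α β γ δ : ℝ) :
    ⟪α • a + β • x, cross (γ • a + δ • x) x⟫ = 0 := by
  simp only [cross, PiLp.inner_apply, RCLike.inner_apply, conj_trivial, Fin.sum_univ_three, cross_apply,
    Matrix.cons_val_zero, Matrix.cons_val_one, Matrix.cons_val_two, Matrix.head_cons, Matrix.tail_cons,
    WithLp.ofLp_add, WithLp.ofLp_smul, Pi.add_apply, Pi.smul_apply, smul_eq_mul, PiLp.add_apply,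
    PiLp.smul_apply]
  ring

/-! ### Second-derivative symmetry through the gradient -/

/-- `⟪D(∇θ)(x)[u], v⟫ = ⟪D(∇θ)(x)[v], u⟫` for `θ` of class `C²` at `x`. -/
theorem inner_fderiv_gradient_symm {θ : EuclideanSpace ℝ (Fin 3) → ℝ} {x : EuclideanSpace ℝ (Fin 3)}
    (hθ : ContDiffAt ℝ 2 θ x) (u v : EuclideanSpace ℝ (Fin 3)) :
    ⟪fderiv ℝ (gradient θ) x u, v⟫ = ⟪fderiv ℝ (gradient θ) x v, u⟫ := by
  have hsymm : IsSymmSndFDerivAt ℝ θ x :=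
    hθ.isSymmSndFDerivAt (by simp only [minSmoothness_of_isRCLikeNormedField]; exact le_rfl)
  have hD : DifferentiableAt ℝ (fderiv ℝ θ) x :=
    (hθ.fderiv_right (m := 1) (by norm_num)).differentiableAt (by simp)
  have hgrad : HasFDerivAt (gradient θ)
      (((InnerProductSpace.toDual ℝ (EuclideanSpace ℝ (Fin 3))).symm :
          (EuclideanSpace ℝ (Fin 3) →L[ℝ] ℝ) →L[ℝ] EuclideanSpace ℝ (Fin 3)).comp (fderiv ℝ (fderiv ℝ θ) x)) x :=
    (InnerProductSpace.toDual ℝ (EuclideanSpace ℝ (Fin 3))).symm.hasFDerivAt.comp x hD.hasFDerivAt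
  have hcomp : ∀ u v : EuclideanSpace ℝ (Fin 3), ⟪fderiv ℝ (gradient θ) x u, v⟫ = fderiv ℝ (fderiv ℝ θ) x u v := by
    intro u v
    rw [hgrad.fderiv]
    exact InnerProductSpace.toDual_symm_apply
  rw [hcomp, hcomp, hsymm]

/-! ### Conjunct (6) -/

section L1

variable {l : ℕ} {H : EuclideanSpace ℝ (Fin 3) → ℝ}

/-- **Conjunct (6) of `HorizonProfileStructure`: `𝔏₁[U] = 0` off the origin** for the horizon profile
`U = horizonProfile l H 0` of a smooth, `l`-homogeneous (`l ≥ 1`), harmonic `H`. -/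
theorem horizonL1_horizonProfile (hl : 1 ≤ l) (hH : ContDiff ℝ (⊤ : ℕ∞) H)
    (hhom : ∀ (c : ℝ) (y : EuclideanSpace ℝ (Fin 3)), H (c • y) = c ^ l * H y)
    (hharm : ∀ y, Laplacian.laplacian H y = 0) {x : EuclideanSpace ℝ (Fin 3)} (hx : x ≠ 0) :
    horizonL1 (horizonProfile l H 0) 0 x = 0 := by
  unfold horizonL1
  rw [sub_zero]
  -- abbreviations
  set U : EuclideanSpace ℝ (Fin 3) → EuclideanSpace ℝ (Fin 3) := horizonProfile l H 0 with hU
  set φ : EuclideanSpace ℝ (Fin 3) → ℝ := fun z => ‖z‖ ^ ((1 : ℤ) - l) * H z with hφ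
  set ψ : EuclideanSpace ℝ (Fin 3) → ℝ := fun z => VectorCalculus.divergence (gradient φ) z with hψ
  have hopen : ∀ᶠ z in 𝓝 x, z ≠ (0 : EuclideanSpace ℝ (Fin 3)) := isOpen_compl_singleton.mem_nhds hx
  have hHd : ∀ z, DifferentiableAt ℝ H z := fun z => (hH.differentiable (by simp)).differentiableAt
  -- regularity of `φ`, `∇φ`, `ψ` at `x`
  have hφC : ∀ {n : WithTop ℕ∞}, n ≤ (⊤ : ℕ∞) → ∀ {z : EuclideanSpace ℝ (Fin 3)}, z ≠ 0 → ContDiffAt ℝ n φ z :=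
    fun hn z hz => contDiffAt_potential hl hH hz hn
  have hφ2 : ContDiffAt ℝ 2 φ x := hφC (by norm_cast) hx
  have hφ3 : ContDiffAt ℝ 3 φ x := hφC (by norm_cast) hx
  have hφ4 : ContDiffAt ℝ 4 φ x := hφC (by norm_cast) hx
  have hgC2 : ContDiffAt ℝ 2 (gradient φ) x :=
    (InnerProductSpace.toDual ℝ (EuclideanSpace ℝ (Fin 3))).symm.contDiff.contDiffAt.comp x
      (hφ3.fderiv_right (m := 2) (by norm_num))
  have hgC3 : ContDiffAt ℝ 3 (gradient φ) x :=
    (InnerProductSpace.toDual ℝ (EuclideanSpace ℝ (Fin 3))).symm.contDiff.contDiffAt.comp x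
      (hφ4.fderiv_right (m := 3) (by norm_num))
  have hgd : DifferentiableAt ℝ (gradient φ) x := hgC2.differentiableAt (by simp)
  have hψC2 : ContDiffAt ℝ 2 ψ x := by
    -- `ψ = tr ∘ D(∇φ)`, `∇φ` is `C³` at `x`
    have hD : ContDiffAt ℝ 2 (fderiv ℝ (gradient φ)) x := hgC3.fderiv_right (m := 2) (by norm_num)
    set T : (EuclideanSpace ℝ (Fin 3) →L[ℝ] EuclideanSpace ℝ (Fin 3)) →ₗ[ℝ] ℝ :=
      (LinearMap.trace ℝ (EuclideanSpace ℝ (Fin 3))).comp (ContinuousLinearMap.coeLM ℝ) with hT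
    have heq : ψ = fun z => T (fderiv ℝ (gradient φ) z) := by funext z; rfl
    rw [heq]
    exact (LinearMap.toContinuousLinearMap T).contDiff.contDiffAt.comp x hD
  have hψd : DifferentiableAt ℝ ψ x := hψC2.differentiableAt (by simp)
  -- the normal form near `x`, and `U` is smooth at `x`
  have hNF : U =ᶠ[𝓝 x] fun z => (2 : ℝ) • gradient φ z - ψ z • z := by
    filter_upwards [hopen] with z hz
    exact horizonProfile_eq_normalForm hl hH hhom hz
  have hUC2 : ContDiffAt ℝ 2 U x := by
    rw [hU, horizonProfile_zero_eq]
    have h4 : ContDiffAt ℝ 4 (fun z : EuclideanSpace ℝ (Fin 3) => (‖z‖ ^ ((1 : ℤ) - l) * H z) • z) x :=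
      hφ4.smul contDiffAt_id
    have hV3 : ContDiffAt ℝ 3 (curl (fun z : EuclideanSpace ℝ (Fin 3) => (‖z‖ ^ ((1 : ℤ) - l) * H z) • z)) x := by
      rw [curl_eq_curlCLM_comp]
      exact curlCLM.contDiff.contDiffAt.comp x (h4.fderiv_right (m := 3) (by norm_num))
    rw [curl_eq_curlCLM_comp (curl _)]
    exact curlCLM.contDiff.contDiffAt.comp x (hV3.fderiv_right (m := 2) (by norm_num))
  have hUd : DifferentiableAt ℝ U x := hUC2.differentiableAt (by simp)
  have hcUd : DifferentiableAt ℝ (curl U) x := by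
    rw [curl_eq_curlCLM_comp]
    exact curlCLM.differentiableAt.comp x ((hUC2.fderiv_right (m := 1) (by norm_num)).differentiableAt (by simp))
  -- tangency of `curl U` everywhere
  have htan : ∀ z : EuclideanSpace ℝ (Fin 3), ⟪curl U z, z - 0⟫ = 0 := by
    intro z
    rw [sub_zero]
    by_cases hz : z = 0
    · rw [hz, inner_zero_right]
    · exact inner_curl_horizonProfile hl hH hhom hz
  -- order-one flux identity at the point
  have hdivc : VectorCalculus.divergence (curl U) x = 0 :=
    HelicityDensityTransport.divergence_curl_eq_zero_of_contDiffAt hUC2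
  have hflux := inner_curl_cross_of_tangent (x₀ := 0) hUd hcUd htan hdivc
  rw [sub_zero] at hflux
  rw [hflux]
  -- `curl U x = −∇ψ(x) × x`
  have hcurl : curl U x = -cross (gradient ψ x) x := by
    rw [curl_eq_curlCLM, hNF.fderiv_eq, ← curl_eq_curlCLM]
    have h1 : DifferentiableAt ℝ (fun z => (2 : ℝ) • gradient φ z) x := hgd.const_smul (2 : ℝ)
    have h2 : DifferentiableAt ℝ (fun z => ψ z • z) x := hψd.smul differentiableAt_id
    rw [curl_sub h1 h2, curl_const_smul hgd, curl_gradient_eq_zero_of_contDiffAt hφ2, smul_zero, zero_sub,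
      curl_smul_self hψd]
  -- `DU(x)[c]` through the normal form
  have hderivNF : HasFDerivAt (fun z : EuclideanSpace ℝ (Fin 3) => (2 : ℝ) • gradient φ z - ψ z • z)
      ((2 : ℝ) • fderiv ℝ (gradient φ) x
        - (ψ x • ContinuousLinearMap.id ℝ (EuclideanSpace ℝ (Fin 3)) + (fderiv ℝ ψ x).smulRight x)) x :=
    (hgd.hasFDerivAt.const_smul (2 : ℝ)).sub (hψd.hasFDerivAt.smul (hasFDerivAt_id x))
  have hDUeq : fderiv ℝ U x = (2 : ℝ) • fderiv ℝ (gradient φ) x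
        - (ψ x • ContinuousLinearMap.id ℝ (EuclideanSpace ℝ (Fin 3)) + (fderiv ℝ ψ x).smulRight x) :=
    (hderivNF.congr_of_eventuallyEq hNF).fderiv
  have hDU : ∀ c : EuclideanSpace ℝ (Fin 3),
      fderiv ℝ U x c = (2 : ℝ) • fderiv ℝ (gradient φ) x c - ((fderiv ℝ ψ x c) • x + ψ x • c) := by
    intro c
    rw [hDUeq]
    simp only [_root_.sub_apply, _root_.FunLike.coe_smul, Pi.smul_apply,
      _root_.add_apply, ContinuousLinearMap.smulRight_apply, ContinuousLinearMap.id_apply]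
    abel
  -- Euler for `∇φ` (degree 0): `D(∇φ)(x)[x] = 0`
  have hφd : ∀ z : EuclideanSpace ℝ (Fin 3), z ≠ 0 → DifferentiableAt ℝ φ z := fun z hz =>
    (hφC (le_refl _) hz).differentiableAt (by simp)
  have hφhom := potential_smul hl hhom
  have hEuler0 : fderiv ℝ (gradient φ) x x = 0 := by
    have hev : ∀ᶠ c in 𝓝 (1 : ℝ), gradient φ (c • x) = (fun _ => (1 : ℝ)) c • gradient φ x := by
      have hcont : Tendsto (fun c : ℝ => c • x) (𝓝 1) (𝓝 x) := by
        have : Continuous fun c : ℝ => c • x := continuous_id.smul continuous_const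
        simpa using this.tendsto 1
      have hev' : ∀ᶠ y in 𝓝 x, DifferentiableAt ℝ φ y := by
        filter_upwards [hopen] with y hy using hφd y hy
      filter_upwards [Ioi_mem_nhds (zero_lt_one' ℝ), hcont.eventually hev'] with c hc hφc
      rw [one_smul]
      exact gradient_smul_of_oneHomogeneous hc (hφd x hx) hφc hφhom
    have h0 := fderiv_apply_self_of_homogeneous (a := fun _ => (1 : ℝ)) hgd (hasDerivAt_const 1 1) hev
    rw [zero_smul] at h0
    exact h0
  -- explicit gradients: `∇φ(x), ∇ψ(x) ∈ span{∇H(x), x}`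
  set a : ℝ := ((1 : ℝ) - l) / 2 with ha
  have hφev : φ =ᶠ[𝓝 x] fun z => H z * (‖z‖ ^ 2) ^ a := by
    filter_upwards [hopen] with z hz using potential_eq_rpow hz
  have hgradφev : gradient φ =ᶠ[𝓝 x] gradient (fun z : EuclideanSpace ℝ (Fin 3) => H z * (‖z‖ ^ 2) ^ a) := by
    filter_upwards [hφev.eventually_nhds] with z hz
    unfold gradient; rw [Filter.EventuallyEq.fderiv_eq hz]
  have hgφ : gradient φ x = ((‖x‖ ^ 2) ^ a) • gradient H x + (2 * (a * (‖x‖ ^ 2) ^ (a - 1)) * H x) • x := by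
    rw [hgradφev.self_of_nhds]; exact gradient_mul_rpow_normSq hx (hHd x) a
  -- `ψ = κ' · H · q^{a−1}` near `x`
  have hψev : ψ =ᶠ[𝓝 x] fun z => (a * (4 * l + 4 * a + 2) * H z) * (‖z‖ ^ 2) ^ (a - 1) := by
    -- at every `z ≠ 0`: `∇φ = ∇(H q^a)` near `z`, so `div ∇φ (z) = div ∇(H q^a)(z)` = the explicit value
    filter_upwards [hgradφev.eventually_nhds, hopen] with z hz hz0
    show VectorCalculus.divergence (gradient φ) z = _
    rw [show VectorCalculus.divergence (gradient φ) z
        = VectorCalculus.divergence (gradient (fun w : EuclideanSpace ℝ (Fin 3) => H w * (‖w‖ ^ 2) ^ a)) z by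
      simp only [VectorCalculus.divergence, Filter.EventuallyEq.fderiv_eq hz],
      divergence_gradient_mul_rpow_normSq hz0 hH hhom hharm a]
    ring
  have hκHd : DifferentiableAt ℝ (fun z : EuclideanSpace ℝ (Fin 3) => a * (4 * l + 4 * a + 2) * H z) x :=
    (hHd x).const_mul _
  have hgψ : gradient ψ x = ((‖x‖ ^ 2) ^ (a - 1)) • gradient (fun z : EuclideanSpace ℝ (Fin 3) => a * (4 * l + 4 * a + 2) * H z) x
      + (2 * ((a - 1) * (‖x‖ ^ 2) ^ (a - 1 - 1)) * (a * (4 * l + 4 * a + 2) * H x)) • x := by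
    have h := gradient_mul_rpow_normSq hx hκHd (a - 1) (H := fun z => a * (4 * l + 4 * a + 2) * H z)
    unfold gradient at h ⊢
    rw [hψev.fderiv_eq]
    exact h
  have hgκH : gradient (fun z : EuclideanSpace ℝ (Fin 3) => a * (4 * l + 4 * a + 2) * H z) x
      = (a * (4 * l + 4 * a + 2)) • gradient H x := by
    apply ext_inner_right ℝ; intro v
    rw [Literature.Analysis.FluidPDE.inner_gradient_left, real_inner_smul_left,
      Literature.Analysis.FluidPDE.inner_gradient_left, fderiv_const_mul (hHd x)]
    simp
  rw [hgκH, smul_smul] at hgψ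
  -- assemble: every term is a triple product with a repeated vector
  set g : EuclideanSpace ℝ (Fin 3) := gradient H x with hg
  set α : ℝ := (‖x‖ ^ 2) ^ a with hα
  set β : ℝ := 2 * (a * (‖x‖ ^ 2) ^ (a - 1)) * H x with hβ
  set γ : ℝ := (‖x‖ ^ 2) ^ (a - 1) * (a * (4 * l + 4 * a + 2)) with hγ
  set δ : ℝ := 2 * ((a - 1) * (‖x‖ ^ 2) ^ (a - 1 - 1)) * (a * (4 * l + 4 * a + 2) * H x) with hδ
  have hc0 : ⟪cross (gradient ψ x) x, x⟫ = 0 := inner_cross_self_right'' _ _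
  have hsym : ⟪fderiv ℝ (gradient φ) x (cross (gradient ψ x) x), x⟫ = 0 := by
    rw [inner_fderiv_gradient_symm hφ2, hEuler0, inner_zero_left]
  have hDψ : fderiv ℝ ψ x (cross (gradient ψ x) x) = 0 := by
    rw [← Literature.Analysis.FluidPDE.inner_gradient_left, hgψ]
    have := inner_cross_eq_zero_of_span g x γ δ γ δ
    exact this
  have hUx : U x = (2 : ℝ) • gradient φ x - ψ x • x := hNF.self_of_nhds
  rw [hcurl, hDU, hUx, hgφ]
  simp only [map_neg, smul_neg, inner_neg_left, inner_neg_right, inner_sub_left, inner_add_left,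
    inner_smul_left, hsym, hDψ, hc0]
  rw [hgψ]
  have h2 : ⟪x, cross (γ • g + δ • x) x⟫ = 0 := inner_self_cross _ _
  have h3 : ⟪g, cross (γ • g + δ • x) x⟫ = 0 := by
    simpa using inner_cross_eq_zero_of_span g x 1 0 γ δ
  simp [h2, h3]

end L1

/-! ### The first lemma, by name -/

/-- **`HorizonProfileStructure` (first lemma «provable now» of ns-idea-15's «horizon-threading-tower», by name against the
Theorems-side twin `ThreadingFluxHorizonTowerDefs.lean`):** for a degree-`l` solid harmonic `H` (`l ≥ 1`) the horizon profile
`U = curl curl(r^{1−l}H y)` is degree-`0` homogeneous, divergence free and unthreaded on `ℝ³ ∖ {0}`, splits as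
`U = (l(l+1)H/r^{l+1}) y + r∇(2H/r^l)` with `r²Δ(2H/r^l) = −2l(l+1)H/r^l`, and `𝔏₁[U] ≡ 0`.  Assembly of conjuncts (1)–(3)
(`ThreadingFluxHorizonTowerProfileCore`), (4)–(5) (`ThreadingFluxHorizonTowerProfileFormulas`) and (6) (this file).
[cite: MajdaBertozziCUP2002, §1.1 (vector identities)] -/
theorem horizonProfileStructure : HorizonProfileStructure := by
  intro l H hl hH hhom hharm
  exact ⟨isZeroHomogeneousAbout_horizonProfile hl hH hhom,
    fun x hx => divergence_horizonProfile hl hH hx,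
    fun x hx => inner_curl_horizonProfile hl hH hhom hx,
    fun x hx => horizonProfile_eq_split hl hH hhom hharm hx,
    fun x hx => laplacian_tangentialPotential hH hhom hharm hx,
    fun x hx => horizonL1_horizonProfile hl hH hhom hharm hx⟩

end Summit.NavierStokesRegularity.NavierStokesRegularity.Theorems.PoloidalLiouville.HorizonTower

end
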